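import Literature.RepresentationTheory.FiniteGroups.SymmetricGroupKroneckerSquareSelfConjugate
import Literature.RepresentationTheory.FiniteGroups.IndexTwoRestriction
import Literature.RepresentationTheory.FiniteGroups.CharacterDegreeDvdCard
import Literature.RepresentationTheory.FiniteGroups.SymmetricGroupIsotypic
import Literature.NumberTheory.DiophantineGeometry.SymmetricGroupRepsSignTwist
import Mathlib.GroupTheory.SpecificGroups.Alternating.Centralizer
import Mathlib.GroupTheory.Perm.Centralizer
import Mathlib.RingTheory.IntegralClosure.IntegrallyClosed
import Mathlib.Algebra.GCDMonoid.IntegrallyClosed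
import Mathlib.Data.List.Lex
import HarnessLib

/-!
# Bessenrodt–Behns 2004, Cor. 3.2 (`[λ] ∈ [λ]²` with multiplicity `≡ 1 mod 4` for `λ = λᵀ`),
# reduced to two Murnaghan–Nakayama hook values (the alternating-group argument)

Sibling proofs file (D-0014) of `SymmetricGroupKroneckerSquareSelfConjugate.lean`, whose named fact
`BessenrodtBehns2004_cor_3_2` — C. Bessenrodt, C. Behns, *On the Durfee size of Kronecker products of
characters of the symmetric group and its double covers*, J. Algebra 280 (2004), Cor. 3.2, p. 135–136:
"Let `λ = λ'` be a partition. Then `[λ]` is a constituent of `[λ]²`. More precisely, it is a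
constituent of multiplicity `≡ 1 mod 4`" — is typed there as
`∀ n λ, λᵀ = λ → 0 < g(λ,λ,λ) ∧ g(λ,λ,λ) % 4 = 1` (`g = kroneckerCoeff ℂ`).

This file PROVES the whole alternating-group argument of the printed proof (Thm. 3.1, Cor. 3.2),
including Frobenius's theorem on the difference character of the two halves of `[λ]↓A_n`
(James–Kerber 2.5.13, via James–Kerber's own proof), EXCEPT two values of irreducible characters of
`S_n` which are instances of the Murnaghan–Nakayama rule along principal hooks (James–Kerber 2.4.8,
2.4.9), isolated as the hypotheses `H1`, `H2` of the final theorem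
`BessenrodtBehns2004_cor_3_2_of_hookValues` (no new definition, no named fact):

* `H1 n` — for every `g₀ ∈ S_n` whose centralizer lies in `A_n` (a split class) there is a
  partition `γ ⊢ n` with `χ^γ(g₀) = ±1` and `χ^γ(g) = 0` for every `g` whose cycle type (sorted
  decreasingly) is lexicographically larger than that of `g₀` (James–Kerber 2.4.8/2.4.9 for the
  partition `γ = h⁻¹(type g₀)` whose principal hook lengths are the cycle lengths of `g₀`);
* `H2 n λ` — for `λ = λᵀ` there is `σ ∈ S_n` with `χ^λ(σ) = ε = ±1` and `4 ∣ ∏(cycle lengths of σ) − ε`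
  (James–Kerber 2.4.8 with 2.5.12 at the class `h(λ)` of principal hook lengths `hᵢ = 2(λᵢ - i) + 1`:
  `ε = (-1)^{(n-k)/2} = ∏ (-1)^{(hᵢ-1)/2} ≡ ∏ hᵢ (mod 4)`).

The companion file `SymmetricGroupPrincipalHookValues.lean` proves `H1`, `H2` from Frobenius's
character formula and concludes `BessenrodtBehns2004_cor_3_2_holds`.

## The printed proof and the proof given here

Bessenrodt–Behns (p. 135–136): for `λ = λᵀ ⊢ n`, `[λ]↓A_n = {λ}₊ + {λ}₋` (Clifford theory), the two
halves differ only on the two `A_n`-classes of cycle type `h(λ)`, where their values are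
`(ε ± √(ε ∏ hᵢ))/2` (Frobenius); Thm. 3.1 compares `{λ}₊²` on these classes, and Cor. 3.2 obtains
`[λ]² = (4(a - δ_{1,ε}) + 1)[λ] + …` with `a = ⟨{λ}₊², {λ}₊⟩`. Here, on the tree's character theory
(`IsCharacter`, `IsIrrChar`, `classInner`):

1. **Splitting** (`exists_alternating_splitting`). `χ = χ^λ` vanishes off `A_n` (`χ^{λᵀ} = sgn χ^λ`,
   `spechtCharacter_transpose`), so `χ↓A_n = ψ₁ + ψ₂` with `ψ₁ ≠ ψ₂ ∈ Irr(A_n)` (J–L 20.9/20.10: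
   `isIrrChar_restrict_or_of_index_two`, `isIrrChar_restrict_iff_exists_apply_ne_zero`) and `ψ₂ = ψ₁ˣ`
   for an odd `x` (Clifford, Isaacs 6.2: `classInner_restrict_eq_zero_of_forall_conjNormal_ne`).
   Put `θ = ψ₁ - ψ₂`; then `θ(πhπ⁻¹) = sgn(π) θ(h)` and `θ` vanishes off the split classes.
2. **Bookkeeping** (`kroneckerCoeff_eq_of_splitting`, `sum_chi_theta_sq_eq_of_splitting`). With
   `p = |A_n|⁻¹ Σ ψ₁³`, `q = |A_n|⁻¹ Σ ψ₁²ψ₂ ∈ ℕ` (multiplicities, `IsCharacter.classInner_natCast`;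
   `Σ ψ₂³ = Σ ψ₁³`, `Σ ψ₁ψ₂² = Σ ψ₁²ψ₂` by `h ↦ xhx⁻¹`): `g(λ,λ,λ) = p + 3q` and
   `Σ_{A_n} χ θ² = |A_n| (2p - 2q)`. Hence `Σ_{A_n} χ θ² = 2|A_n|` gives `p = q + 1`, `g = 4q + 1`.
3. **Frobenius's theorem** (James–Kerber 2.5.13, proof steps (i), (ii), (v)):
   `Σ_{A_n} |θ|² = 2|A_n|` (`⟨θ,θ⟩ = 2`); for every `γ ⊢ n`, `Σ_{A_n} |θ|² χ^γ ∈ 2|A_n| ℤ`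
   (`= 2|A_n|(⟨ψ₁χ^γ, ψ₁⟩ - ⟨ψ₁χ^γ, ψ₂⟩)` after `h ↦ xhx⁻¹`); taking `h₀` in the support of `θ` with
   lexicographically minimal cycle type and `γ` from `H1`, `Σ |θ|² χ^γ = N |θ(h₀)|² χ^γ(h₀)` with
   `N = |class of h₀|`, so `N |θ(h₀)|² ≥ n!`, whence (total mass `n!`) `θ` is supported on the class of
   `h₀` and `N|θ(h₀)|² = n!`; the `σ` of `H2` lies in this class because `ψ₁(σ) = (ε + θ(σ))/2` is an
   algebraic integer (`θ(σ) ≠ 0`), so `|θ(σ)|² = ∏ (cycle lengths of σ) =: z` (Mathlib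
   `Equiv.Perm.card_of_cycleType_mul_eq`).
4. **The sign** (replacing James–Kerber's step (vi) on ambivalent classes): `θ(σ)² = s z` with
   `s = ±1` (`θ(σ⁻¹) = conj θ(σ) = ±θ(σ)`); if `s = -ε` then, with `z ≡ ε (mod 4)` from `H2`,
   `u = ψ₁(σ)² - εψ₁(σ) + εm` is an algebraic integer with `2u = -1` — impossible. So
   `θ(σ)² = ε z` and `Σ_{A_n} χ θ² = N ε θ(σ)² = N z = n! = 2|A_n|`.

Honest framing: classical character theory of `S_n`/`A_n`, vendored for the cell `val-lit`
(LADDER-VALIANT V3 bookkeeping: the by-name second route `kronRect_self_pos_of_BB04` of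
`BI17GenericPeriodOddFormatsProofs.lean`); nothing here bears on VP versus VNP.

## References

* C. Bessenrodt, C. Behns, J. Algebra 280 (2004) 132–144, §3: Thm. 3.1, Cor. 3.2 (p. 135–136).
  [BessenrodtBehns2004]
* G. James, A. Kerber, *The Representation Theory of the Symmetric Group*, Encyclopedia Math.
  Appl. 16 (1981): 2.4.7–2.4.9 (Murnaghan–Nakayama, principal hooks), 2.5.7, 2.5.12, 2.5.13 and its
  proof (i)–(vi). [JamesKerber1981]
* G. James, M. Liebeck, *Representations and Characters of Groups* (2001), Prop. 20.9–20.12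
  (index two). [JamesLiebeck2001]
* I. M. Isaacs, *Character Theory of Finite Groups* (1976), Thm. 6.2 (Clifford). [Isaacs1976]

## Mathlib and tree

Mathlib: `alternatingGroup.index_eq_two`, `Equiv.Perm.centralizer_le_alternating_iff`,
`Equiv.Perm.card_of_cycleType_mul_eq`, `Equiv.Perm.isConj_iff_cycleType_eq`, `Equiv.Perm.cycleType_inv`,
`Finset.exists_min_image` (with Mathlib's lexicographic `LinearOrder (List ℕ)`), `IsIntegrallyClosed`.
Tree: `isIrrChar_spechtCharacter`, `spechtCharacter_transpose`, `kroneckerCoeff_eq_sum_spechtCharacter_holds`,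
`isIrrChar_restrict_or_of_index_two`, `isIrrChar_restrict_iff_exists_apply_ne_zero`,
`classInner_restrict_eq_zero_of_forall_conjNormal_ne`, `IsIrrChar.conjNormal`, `IsClassFun.conjNormal_coe`,
`conjNormal_conjNormal`, `IsIrrChar.classInner_eq`, `IsCharacter.classInner_natCast`, `IsCharacter.mul`,
`IsCharacter.restrict`, `isCharacter_one`, `IsCharacter.apply_inv_eq_conj`, `IsCharacter.isIntegral_apply`.
-/

noncomputable section

open scoped BigOperators

namespace Literature.RepresentationTheory.FiniteGroups

open Literature.NumberTheory.DiophantineGeometry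

variable {n : ℕ}

/-! ### Generalities -/

/-- A sum over `S_n` of a function vanishing off `A_n` is the sum over `A_n`. [folklore] -/
private theorem sum_eq_sum_alternatingGroup {F : Equiv.Perm (Fin n) → ℂ}
    (hF : ∀ g, g ∉ alternatingGroup (Fin n) → F g = 0) :
    ∑ g, F g = ∑ h : alternatingGroup (Fin n), F h := by
  classical
  have h1 : ∑ h : alternatingGroup (Fin n), F h =
      ∑ g ∈ Finset.univ.filter (fun g => g ∈ alternatingGroup (Fin n)), F g :=
    (Finset.sum_subtype _ (fun g => by simp) F).symm
  rw [h1, Finset.sum_filter]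
  exact Finset.sum_congr rfl fun g _ => by
    split_ifs with hg
    · rfl
    · exact hF g hg

/-- **`χ^λ` vanishes off `A_n` when `λ = λᵀ`** (`χ^{λᵀ} = sgn · χ^λ`, James LNM 682, 6.6).
[cite: JamesKerber1981, 2.5.7] -/
theorem spechtCharacter_eq_zero_of_not_mem_alternatingGroup (lam : Nat.Partition n)
    (hT : lam.transpose = lam) {g : Equiv.Perm (Fin n)} (hg : g ∉ alternatingGroup (Fin n)) :
    spechtCharacter ℂ lam g = 0 := by
  have h := spechtCharacter_transpose ℂ lam g
  rw [hT] at h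
  rw [Equiv.Perm.mem_alternatingGroup] at hg
  have hs : Equiv.Perm.sign g = -1 := (Int.units_eq_one_or _).resolve_left hg
  rw [hs, Units.val_neg, Units.val_one, Int.cast_neg, Int.cast_one, neg_one_mul] at h
  have h2 : (2 : ℂ) * spechtCharacter ℂ lam g = 0 := by linear_combination h
  exact (mul_eq_zero.mp h2).resolve_left two_ne_zero

/-- `χ^λ(g) ≠ 0` forces `g ∈ A_n` when `λ = λᵀ`. [cite: JamesKerber1981, 2.5.7] -/
theorem mem_alternatingGroup_of_spechtCharacter_ne_zero (lam : Nat.Partition n)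
    (hT : lam.transpose = lam) {g : Equiv.Perm (Fin n)} (hg : spechtCharacter ℂ lam g ≠ 0) :
    g ∈ alternatingGroup (Fin n) := by
  by_contra h
  exact hg (spechtCharacter_eq_zero_of_not_mem_alternatingGroup lam hT h)

/-- `±1/2` is not an algebraic integer: if `t` is integral over `ℤ` then `2t ≠ ±1`
(`ℤ` is integrally closed). [folklore] -/
private theorem two_mul_ne_of_isIntegral_int {t : ℂ} (ht : IsIntegral ℤ t) {ε : ℂ} (hε : ε = 1 ∨ ε = -1) :
    2 * t ≠ ε := by
  intro h2
  obtain ⟨e, he, rfl⟩ : ∃ e : ℤ, (e = 1 ∨ e = -1) ∧ (e : ℂ) = ε := by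
    rcases hε with rfl | rfl
    · exact ⟨1, Or.inl rfl, by norm_num⟩
    · exact ⟨-1, Or.inr rfl, by norm_num⟩
  have ht' : t = algebraMap ℚ ℂ ((e : ℚ) / 2) := by
    have h2' : t = (e : ℂ) / 2 := by rw [eq_div_iff two_ne_zero, mul_comm]; exact h2
    rw [h2', eq_ratCast, Rat.cast_div, Rat.cast_intCast, Rat.cast_ofNat]
  letI : IsIntegrallyClosed ℤ := GCDMonoid.toIsIntegrallyClosed
  rw [ht', isIntegral_algebraMap_iff (algebraMap ℚ ℂ).injective,
    IsIntegrallyClosed.isIntegral_iff] at ht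
  obtain ⟨m, hm⟩ := ht
  have hm' : (2 * m : ℚ) = e := by
    rw [show (algebraMap ℤ ℚ) m = (m : ℚ) from rfl] at hm
    rw [hm]; ring
  have h2m : 2 * m = e := by exact_mod_cast hm'
  rcases he with rfl | rfl <;> omega

/-! ### The case `n ≤ 1` -/

/-- For `n ≤ 1`, `g(λ, λ, λ) = 1` (`S_n` is trivial, `χ^λ = 1`). [folklore] -/
private theorem kroneckerCoeff_self_of_le_one (hn : n ≤ 1) (lam : Nat.Partition n) :
    kroneckerCoeff ℂ lam lam lam = 1 := by
  classical
  haveI : Subsingleton (Fin n) := by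
    rcases Nat.le_one_iff_eq_zero_or_eq_one.mp hn with rfl | rfl <;> infer_instance
  have hirr := isIrrChar_spechtCharacter lam
  obtain ⟨d, -, hd⟩ := hirr.exists_apply_one
  have hcard : Fintype.card (Equiv.Perm (Fin n)) = 1 := by
    rw [Fintype.card_perm, Fintype.card_fin]; exact Nat.factorial_eq_one.mpr hn
  -- `⟨χ, χ⟩ = 1` with one summand: `χ(1)² = 1`, so `χ(1) = 1`
  have hsq := hirr.classInner_eq hirr
  rw [if_pos rfl, classInner_apply, Fintype.sum_subsingleton _ 1, inv_one, hd, hcard,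
    Nat.cast_one, inv_one, one_mul] at hsq
  have hd1 : d = 1 := by
    have h' : d * d = 1 := by exact_mod_cast hsq
    exact Nat.eq_one_of_mul_eq_one_right h'
  -- `n! g = ∑ χ³ = 1`
  have h := kroneckerCoeff_eq_sum_spechtCharacter_holds ℂ lam lam lam
  rw [Fintype.sum_subsingleton _ 1, hd, hd1, Nat.cast_one, mul_one, mul_one,
    show n.factorial = 1 from Nat.factorial_eq_one.mpr hn, one_mul, Nat.cast_eq_one] at h
  exact h

/-! ### Splitting of `χ^λ↓A_n` for `λ = λᵀ` (Clifford theory, index two) -/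

/-- `|S_n : A_n| = 2` for `n ≥ 2`. [folklore] -/
private theorem index_alternatingGroup_fin (hn : 2 ≤ n) : (alternatingGroup (Fin n)).index = 2 := by
  haveI : Nontrivial (Fin n) := Fin.nontrivial_iff_two_le.mpr hn
  exact alternatingGroup.index_eq_two

/-- **`[λ]↓A_n = {λ}₊ + {λ}₋` for `λ = λᵀ`** (James–Kerber 2.5.7; here via James–Liebeck 20.9/20.10
and Clifford's theorem): `χ^λ↓A_n = ψ₁ + ψ₂` with `ψ₁ ≠ ψ₂` irreducible characters of `A_n`, and
`ψ₂ = ψ₁ˣ` is the conjugate of `ψ₁` by an odd permutation `x`. [cite: JamesKerber1981, 2.5.7] -/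
theorem exists_alternating_splitting (hn : 2 ≤ n) (lam : Nat.Partition n)
    (hT : lam.transpose = lam) :
    ∃ (ψ₁ ψ₂ : alternatingGroup (Fin n) → ℂ) (x : Equiv.Perm (Fin n)),
      IsIrrChar (alternatingGroup (Fin n)) ψ₁ ∧ IsIrrChar (alternatingGroup (Fin n)) ψ₂ ∧ ψ₁ ≠ ψ₂ ∧
      (fun h : alternatingGroup (Fin n) => spechtCharacter ℂ lam h) = ψ₁ + ψ₂ ∧
      x ∉ alternatingGroup (Fin n) ∧
      ψ₂ = fun h => ψ₁ (MulAut.conjNormal x h) := by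
  classical
  have h2 : (alternatingGroup (Fin n)).index = 2 := index_alternatingGroup_fin hn
  have hχ := isIrrChar_spechtCharacter lam
  have hnot : ¬ IsIrrChar (alternatingGroup (Fin n))
      (fun h : alternatingGroup (Fin n) => spechtCharacter ℂ lam h) := by
    intro hirr
    obtain ⟨g, hg, hne⟩ :=
      (isIrrChar_restrict_iff_exists_apply_ne_zero (alternatingGroup (Fin n)) h2 hχ).mp hirr
    exact hne (spechtCharacter_eq_zero_of_not_mem_alternatingGroup lam hT hg)
  obtain ⟨ψ₁, ψ₂, hψ₁, hψ₂, hne, -, hsum⟩ :=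
    (isIrrChar_restrict_or_of_index_two (alternatingGroup (Fin n)) h2 hχ).resolve_left hnot
  have he₁ : classInner (fun h : alternatingGroup (Fin n) => spechtCharacter ℂ lam h) ψ₁ ≠ 0 := by
    rw [hsum, classInner_add_left, hψ₁.classInner_eq hψ₁, hψ₂.classInner_eq hψ₁, if_pos rfl,
      if_neg (Ne.symm hne)]
    norm_num
  have he₂ : classInner (fun h : alternatingGroup (Fin n) => spechtCharacter ℂ lam h) ψ₂ ≠ 0 := by
    rw [hsum, classInner_add_left, hψ₁.classInner_eq hψ₂, hψ₂.classInner_eq hψ₂, if_pos rfl,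
      if_neg hne]
    norm_num
  have hex : ∃ x : Equiv.Perm (Fin n),
      (fun h : alternatingGroup (Fin n) => ψ₁ (MulAut.conjNormal x h)) = ψ₂ := by
    by_contra hall
    push Not at hall
    exact he₂ (classInner_restrict_eq_zero_of_forall_conjNormal_ne hχ hψ₁ he₁ hψ₂ hall)
  obtain ⟨x, hx⟩ := hex
  have hxA : x ∉ alternatingGroup (Fin n) := by
    intro hxA
    apply hne
    rw [← hx]
    exact (hψ₁.isCharacter.isClassFun.conjNormal_coe ⟨x, hxA⟩).symm
  exact ⟨ψ₁, ψ₂, x, hψ₁, hψ₂, hne, hsum, hxA, hx.symm⟩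

/-- **Conjugation of the two halves** (James–Kerber 2.5.7: `{λ}₊^{(12)} ≃ {λ}₋`): even permutations
fix `ψ₁`, `ψ₂`, odd permutations swap them. [cite: JamesKerber1981, 2.5.7] -/
theorem conjNormal_apply_of_splitting (hn : 2 ≤ n) {ψ₁ ψ₂ : alternatingGroup (Fin n) → ℂ}
    (hψ₁ : IsIrrChar (alternatingGroup (Fin n)) ψ₁) {x : Equiv.Perm (Fin n)}
    (hx : x ∉ alternatingGroup (Fin n)) (hconj : ψ₂ = fun h => ψ₁ (MulAut.conjNormal x h))
    (π : Equiv.Perm (Fin n)) (h : alternatingGroup (Fin n)) :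
    (π ∈ alternatingGroup (Fin n) →
        ψ₁ (MulAut.conjNormal π h) = ψ₁ h ∧ ψ₂ (MulAut.conjNormal π h) = ψ₂ h) ∧
    (π ∉ alternatingGroup (Fin n) →
        ψ₁ (MulAut.conjNormal π h) = ψ₂ h ∧ ψ₂ (MulAut.conjNormal π h) = ψ₁ h) := by
  have h2 : (alternatingGroup (Fin n)).index = 2 := index_alternatingGroup_fin hn
  have hcf₁ : IsClassFun ψ₁ := hψ₁.isCharacter.isClassFun
  have hψ₂ : IsIrrChar (alternatingGroup (Fin n)) ψ₂ := by rw [hconj]; exact hψ₁.conjNormal x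
  have hcf₂ : IsClassFun ψ₂ := hψ₂.isCharacter.isClassFun
  -- even conjugation fixes class functions of `A_n`
  have hfix : ∀ {φ : alternatingGroup (Fin n) → ℂ}, IsClassFun φ →
      ∀ {κ : Equiv.Perm (Fin n)}, κ ∈ alternatingGroup (Fin n) →
        ∀ k : alternatingGroup (Fin n), φ (MulAut.conjNormal κ k) = φ k := by
    intro φ hφ κ hκ k
    exact congrFun (hφ.conjNormal_coe ⟨κ, hκ⟩) k
  refine ⟨fun hπ => ⟨hfix hcf₁ hπ h, hfix hcf₂ hπ h⟩, fun hπ => ⟨?_, ?_⟩⟩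
  · -- `π = x k` with `k` even
    have hk : x⁻¹ * π ∈ alternatingGroup (Fin n) := by
      rw [Subgroup.mul_mem_iff_of_index_two h2]
      exact ⟨fun h' => absurd ((alternatingGroup (Fin n)).inv_mem_iff.mp h') hx,
        fun h' => absurd h' hπ⟩
    have hπ' : π = x * (x⁻¹ * π) := by group
    rw [hπ', map_mul, MulAut.mul_apply, ← congrFun hconj (MulAut.conjNormal (x⁻¹ * π) h)]
    exact hfix hcf₂ hk h
  · rw [hconj]
    show ψ₁ (MulAut.conjNormal x (MulAut.conjNormal π h)) = ψ₁ h
    rw [← MulAut.mul_apply, ← map_mul]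
    have hxπ : x * π ∈ alternatingGroup (Fin n) := by
      rw [Subgroup.mul_mem_iff_of_index_two h2]
      exact ⟨fun h' => absurd h' hx, fun h' => absurd h' hπ⟩
    exact hfix hcf₁ hxπ h

/-- The difference character `θ = ψ₁ - ψ₂` under conjugation: `θ(πhπ⁻¹) = sgn(π) θ(h)`
(James–Kerber 2.5.13 (i)). [cite: JamesKerber1981, 2.5.13 proof step (i)] -/
theorem theta_conjNormal_of_splitting (hn : 2 ≤ n) {ψ₁ ψ₂ : alternatingGroup (Fin n) → ℂ}
    (hψ₁ : IsIrrChar (alternatingGroup (Fin n)) ψ₁) {x : Equiv.Perm (Fin n)}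
    (hx : x ∉ alternatingGroup (Fin n)) (hconj : ψ₂ = fun h => ψ₁ (MulAut.conjNormal x h))
    (π : Equiv.Perm (Fin n)) (h : alternatingGroup (Fin n)) :
    ψ₁ (MulAut.conjNormal π h) - ψ₂ (MulAut.conjNormal π h) =
      ((Equiv.Perm.sign π : ℤ) : ℂ) * (ψ₁ h - ψ₂ h) := by
  obtain ⟨heven, hodd⟩ := conjNormal_apply_of_splitting hn hψ₁ hx hconj π h
  by_cases hπ : π ∈ alternatingGroup (Fin n)
  · obtain ⟨h1, h2⟩ := heven hπ
    rw [h1, h2, Equiv.Perm.mem_alternatingGroup.mp hπ, Units.val_one, Int.cast_one, one_mul]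
  · obtain ⟨h1, h2⟩ := hodd hπ
    have hs : Equiv.Perm.sign π = -1 :=
      (Int.units_eq_one_or _).resolve_left (fun h' => hπ (Equiv.Perm.mem_alternatingGroup.mpr h'))
    rw [h1, h2, hs, Units.val_neg, Units.val_one, Int.cast_neg, Int.cast_one]
    ring

/-- **`θ` vanishes off the split classes**: if an odd permutation commutes with `h` then
`θ(h) = 0` (James–Kerber 2.5.13 (i); Mathlib's `Equiv.Perm.centralizer_le_alternating_iff`
describes the split classes). [cite: JamesKerber1981, 2.5.13 proof step (i)] -/
theorem theta_eq_zero_of_not_centralizer_le (hn : 2 ≤ n) {ψ₁ ψ₂ : alternatingGroup (Fin n) → ℂ}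
    (hψ₁ : IsIrrChar (alternatingGroup (Fin n)) ψ₁) {x : Equiv.Perm (Fin n)}
    (hx : x ∉ alternatingGroup (Fin n)) (hconj : ψ₂ = fun h => ψ₁ (MulAut.conjNormal x h))
    (h : alternatingGroup (Fin n))
    (hc : ¬ Subgroup.centralizer {(h : Equiv.Perm (Fin n))} ≤ alternatingGroup (Fin n)) :
    ψ₁ h - ψ₂ h = 0 := by
  rw [SetLike.le_def, not_forall] at hc
  obtain ⟨π, hπ⟩ := hc
  rw [Classical.not_imp, Subgroup.mem_centralizer_singleton_iff] at hπ
  obtain ⟨hcomm, hπA⟩ := hπ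
  have hfix : MulAut.conjNormal π h = h := by
    apply Subtype.ext
    rw [MulAut.conjNormal_apply, hcomm, mul_inv_cancel_right]
  have h' := theta_conjNormal_of_splitting hn hψ₁ hx hconj π h
  have hs : Equiv.Perm.sign π = -1 :=
    (Int.units_eq_one_or _).resolve_left (fun h'' => hπA (Equiv.Perm.mem_alternatingGroup.mpr h''))
  rw [hfix, hs, Units.val_neg, Units.val_one, Int.cast_neg, Int.cast_one, neg_one_mul,
    eq_neg_iff_add_eq_zero, ← two_mul, mul_eq_zero] at h'
  exact h'.resolve_left two_ne_zero

/-- Reindexing a sum over `A_n` by the odd conjugation `h ↦ xhx⁻¹` swaps `ψ₁` and `ψ₂`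
(also at `h⁻¹`), for any weight `c` invariant under that conjugation. [folklore] -/
private theorem sum_swap_of_splitting (hn : 2 ≤ n) {ψ₁ ψ₂ : alternatingGroup (Fin n) → ℂ}
    (hψ₁ : IsIrrChar (alternatingGroup (Fin n)) ψ₁) {x : Equiv.Perm (Fin n)}
    (hx : x ∉ alternatingGroup (Fin n)) (hconj : ψ₂ = fun h => ψ₁ (MulAut.conjNormal x h))
    (c : alternatingGroup (Fin n) → ℂ) (hc : ∀ h, c (MulAut.conjNormal x h) = c h)
    (F : ℂ → ℂ → ℂ → ℂ → ℂ) :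
    ∑ h : alternatingGroup (Fin n), c h * F (ψ₁ h) (ψ₂ h) (ψ₁ h⁻¹) (ψ₂ h⁻¹) =
      ∑ h : alternatingGroup (Fin n), c h * F (ψ₂ h) (ψ₁ h) (ψ₂ h⁻¹) (ψ₁ h⁻¹) := by
  have hsw : ∀ k : alternatingGroup (Fin n),
      ψ₁ (MulAut.conjNormal x k) = ψ₂ k ∧ ψ₂ (MulAut.conjNormal x k) = ψ₁ k :=
    fun k => (conjNormal_apply_of_splitting hn hψ₁ hx hconj x k).2 hx
  symm
  refine Fintype.sum_equiv (MulAut.conjNormal x).toEquiv _ _ fun k => ?_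
  simp only [MulEquiv.toEquiv_eq_coe, MulEquiv.coe_toEquiv]
  rw [hc k, ← map_inv, (hsw k).1, (hsw k).2, (hsw k⁻¹).1, (hsw k⁻¹).2]

/-! ### Bookkeeping: `g(λ,λ,λ) = p + 3q` and `Σ_{A_n} χ θ² = |A_n|(2p - 2q)` -/

/-- `n! = 2 |A_n|` for `n ≥ 2`. [folklore] -/
private theorem factorial_eq_two_mul_card_alternatingGroup (hn : 2 ≤ n) :
    (n.factorial : ℂ) = 2 * Fintype.card (alternatingGroup (Fin n)) := by
  have h := (alternatingGroup (Fin n)).index_mul_card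
  rw [index_alternatingGroup_fin hn, Nat.card_eq_fintype_card, Nat.card_eq_fintype_card,
    Fintype.card_perm, Fintype.card_fin] at h
  exact_mod_cast h.symm

/-- `Σ_h φ(h) ψ(h⁻¹) = |A| ⟨φ, ψ⟩`. [folklore] -/
private theorem sum_mul_apply_inv_eq_card_mul_classInner {A : Type} [Group A] [Fintype A] (φ ψ : A → ℂ) :
    ∑ h : A, φ h * ψ h⁻¹ = Fintype.card A * classInner φ ψ := by
  rw [classInner_apply, mul_inv_cancel_left₀ (Nat.cast_ne_zero.mpr Fintype.card_ne_zero)]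

/-- **Bessenrodt–Behns' bookkeeping** (Cor. 3.2, proof): with `p = |A_n|⁻¹ Σ ψ₁³ = ⟨ψ₁², ψ̄₁⟩` and
`q = |A_n|⁻¹ Σ ψ₁²ψ₂ = ⟨ψ₁², ψ̄₂⟩` (natural numbers), `g(λ,λ,λ) = p + 3q` and
`Σ_{A_n} χ^λ (ψ₁ - ψ₂)² = |A_n| (2p - 2q)`. (In print: `a = ⟨{λ}₊², {λ}₊⟩`,
`[λ]² = (4(a - δ_{1,ε}) + 1)[λ] + …`.) [cite: BessenrodtBehns2004, Cor. 3.2 (proof)] -/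
theorem kroneckerCoeff_eq_of_splitting (hn : 2 ≤ n) (lam : Nat.Partition n)
    (hT : lam.transpose = lam) {ψ₁ ψ₂ : alternatingGroup (Fin n) → ℂ}
    (hψ₁ : IsIrrChar (alternatingGroup (Fin n)) ψ₁) (hψ₂ : IsIrrChar (alternatingGroup (Fin n)) ψ₂)
    {x : Equiv.Perm (Fin n)} (hx : x ∉ alternatingGroup (Fin n))
    (hconj : ψ₂ = fun h => ψ₁ (MulAut.conjNormal x h))
    (hsum : (fun h : alternatingGroup (Fin n) => spechtCharacter ℂ lam h) = ψ₁ + ψ₂) :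
    ∃ p q : ℕ, (kroneckerCoeff ℂ lam lam lam : ℂ) = p + 3 * q ∧
      ∑ h : alternatingGroup (Fin n), spechtCharacter ℂ lam h * (ψ₁ h - ψ₂ h) ^ 2 =
        (Fintype.card (alternatingGroup (Fin n)) : ℂ) * (2 * p - 2 * q) := by
  classical
  obtain ⟨p, hp⟩ := ((hψ₁.isCharacter.mul hψ₁.isCharacter).mul hψ₁.isCharacter).classInner_natCast
    (isCharacter_one (G := alternatingGroup (Fin n)))
  obtain ⟨q, hq⟩ := ((hψ₁.isCharacter.mul hψ₁.isCharacter).mul hψ₂.isCharacter).classInner_natCast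
    (isCharacter_one (G := alternatingGroup (Fin n)))
  have hA0 : (Fintype.card (alternatingGroup (Fin n)) : ℂ) ≠ 0 :=
    Nat.cast_ne_zero.mpr Fintype.card_ne_zero
  have hp' : ∑ h : alternatingGroup (Fin n), ψ₁ h * ψ₁ h * ψ₁ h =
      Fintype.card (alternatingGroup (Fin n)) * p := by
    rw [← hp, ← sum_mul_apply_inv_eq_card_mul_classInner]
    simp only [Pi.mul_apply, Pi.one_apply, mul_one]
  have hq' : ∑ h : alternatingGroup (Fin n), ψ₁ h * ψ₁ h * ψ₂ h =
      Fintype.card (alternatingGroup (Fin n)) * q := by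
    rw [← hq, ← sum_mul_apply_inv_eq_card_mul_classInner]
    simp only [Pi.mul_apply, Pi.one_apply, mul_one]
  have hswap3 : ∑ h : alternatingGroup (Fin n), ψ₂ h * ψ₂ h * ψ₂ h =
      ∑ h : alternatingGroup (Fin n), ψ₁ h * ψ₁ h * ψ₁ h := by
    have h := sum_swap_of_splitting hn hψ₁ hx hconj (fun _ => 1) (fun _ => rfl)
      (fun a _ _ _ => a * a * a)
    simp only [one_mul] at h
    exact h.symm
  have hswap2 : ∑ h : alternatingGroup (Fin n), ψ₁ h * ψ₂ h * ψ₂ h =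
      ∑ h : alternatingGroup (Fin n), ψ₁ h * ψ₁ h * ψ₂ h := by
    have h := sum_swap_of_splitting hn hψ₁ hx hconj (fun _ => 1) (fun _ => rfl)
      (fun a b _ _ => a * a * b)
    simp only [one_mul] at h
    rw [h]
    exact Finset.sum_congr rfl fun h _ => by ring
  have hχ : ∀ h : alternatingGroup (Fin n), spechtCharacter ℂ lam h = ψ₁ h + ψ₂ h := fun h => by
    have := congrFun hsum h
    simpa only [Pi.add_apply] using this
  refine ⟨p, q, ?_, ?_⟩
  · have h := kroneckerCoeff_eq_sum_spechtCharacter_holds ℂ lam lam lam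
    rw [sum_eq_sum_alternatingGroup (F := fun g => spechtCharacter ℂ lam g *
        spechtCharacter ℂ lam g * spechtCharacter ℂ lam g) (fun g hg => by
        rw [spechtCharacter_eq_zero_of_not_mem_alternatingGroup lam hT hg, mul_zero])] at h
    have hterm : ∀ h : alternatingGroup (Fin n),
        spechtCharacter ℂ lam h * spechtCharacter ℂ lam h * spechtCharacter ℂ lam h =
          ψ₁ h * ψ₁ h * ψ₁ h + 3 * (ψ₁ h * ψ₁ h * ψ₂ h) + 3 * (ψ₁ h * ψ₂ h * ψ₂ h) +
            ψ₂ h * ψ₂ h * ψ₂ h := by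
      intro h; rw [hχ h]; ring
    rw [Finset.sum_congr rfl (fun h _ => hterm h), Finset.sum_add_distrib, Finset.sum_add_distrib,
      Finset.sum_add_distrib, ← Finset.mul_sum, ← Finset.mul_sum, hswap3, hswap2, hp', hq',
      Nat.cast_mul, factorial_eq_two_mul_card_alternatingGroup hn] at h
    have h' : (Fintype.card (alternatingGroup (Fin n)) : ℂ) * (2 * kroneckerCoeff ℂ lam lam lam) =
        Fintype.card (alternatingGroup (Fin n)) * (2 * p + 6 * q) := by
      linear_combination h
    have h'' := mul_left_cancel₀ hA0 h'
    linear_combination h'' / 2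
  · have hterm : ∀ h : alternatingGroup (Fin n), spechtCharacter ℂ lam h * (ψ₁ h - ψ₂ h) ^ 2 =
        ψ₁ h * ψ₁ h * ψ₁ h - ψ₁ h * ψ₁ h * ψ₂ h - ψ₁ h * ψ₂ h * ψ₂ h + ψ₂ h * ψ₂ h * ψ₂ h := by
      intro h; rw [hχ h]; ring
    rw [Finset.sum_congr rfl (fun h _ => hterm h), Finset.sum_add_distrib, Finset.sum_sub_distrib,
      Finset.sum_sub_distrib, hswap3, hswap2, hp', hq']
    ring

/-! ### Frobenius's theorem on `θ = ψ₁ - ψ₂` (James–Kerber 2.5.13) -/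

/-- **`⟨θ, θ⟩_{A_n} = 2`**: `Σ_{A_n} θ(h) θ(h⁻¹) = 2|A_n|` (`ψ₁ ≠ ψ₂` irreducible).
[cite: JamesKerber1981, 2.5.13 proof step (ii) eq. (2)] -/
theorem sum_theta_mul_theta_inv_of_splitting {ψ₁ ψ₂ : alternatingGroup (Fin n) → ℂ}
    (hψ₁ : IsIrrChar (alternatingGroup (Fin n)) ψ₁) (hψ₂ : IsIrrChar (alternatingGroup (Fin n)) ψ₂)
    (hne : ψ₁ ≠ ψ₂) :
    ∑ h : alternatingGroup (Fin n), (ψ₁ h - ψ₂ h) * (ψ₁ h⁻¹ - ψ₂ h⁻¹) =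
      2 * Fintype.card (alternatingGroup (Fin n)) := by
  classical
  have hterm : ∀ h : alternatingGroup (Fin n), (ψ₁ h - ψ₂ h) * (ψ₁ h⁻¹ - ψ₂ h⁻¹) =
      ψ₁ h * ψ₁ h⁻¹ - ψ₁ h * ψ₂ h⁻¹ - ψ₂ h * ψ₁ h⁻¹ + ψ₂ h * ψ₂ h⁻¹ := fun h => by ring
  rw [Finset.sum_congr rfl (fun h _ => hterm h), Finset.sum_add_distrib, Finset.sum_sub_distrib,
    Finset.sum_sub_distrib, sum_mul_apply_inv_eq_card_mul_classInner,
    sum_mul_apply_inv_eq_card_mul_classInner, sum_mul_apply_inv_eq_card_mul_classInner,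
    sum_mul_apply_inv_eq_card_mul_classInner, hψ₁.classInner_eq hψ₁, hψ₁.classInner_eq hψ₂,
    hψ₂.classInner_eq hψ₁, hψ₂.classInner_eq hψ₂, if_pos rfl, if_pos rfl, if_neg hne,
    if_neg (Ne.symm hne)]
  ring

/-- **`⟨|θ|² χ^γ↓A_n, 1⟩ ∈ 2ℤ`** (James–Kerber 2.5.13 (i): "`(φ̃^α, ζ^β) ∈ ℤ`"): for every `γ ⊢ n`,
`Σ_{A_n} θ(h) θ(h⁻¹) χ^γ(h) = 2|A_n| (⟨ψ₁χ^γ, ψ₁⟩ - ⟨ψ₁χ^γ, ψ₂⟩)`.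
[cite: JamesKerber1981, 2.5.13 proof step (i)] -/
theorem exists_sum_theta_mul_theta_inv_mul_spechtCharacter_eq (hn : 2 ≤ n)
    {ψ₁ ψ₂ : alternatingGroup (Fin n) → ℂ}
    (hψ₁ : IsIrrChar (alternatingGroup (Fin n)) ψ₁) (hψ₂ : IsIrrChar (alternatingGroup (Fin n)) ψ₂)
    {x : Equiv.Perm (Fin n)} (hx : x ∉ alternatingGroup (Fin n))
    (hconj : ψ₂ = fun h => ψ₁ (MulAut.conjNormal x h)) (γ : Nat.Partition n) :
    ∃ m : ℤ, ∑ h : alternatingGroup (Fin n),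
        (ψ₁ h - ψ₂ h) * (ψ₁ h⁻¹ - ψ₂ h⁻¹) * spechtCharacter ℂ γ h =
      2 * Fintype.card (alternatingGroup (Fin n)) * m := by
  classical
  set c : alternatingGroup (Fin n) → ℂ := fun h => spechtCharacter ℂ γ h with hcdef
  have hc : IsCharacter (alternatingGroup (Fin n)) c :=
    (isIrrChar_spechtCharacter γ).isCharacter.restrict (alternatingGroup (Fin n))
  obtain ⟨a, ha⟩ := (hψ₁.isCharacter.mul hc).classInner_natCast hψ₁.isCharacter
  obtain ⟨b, hb⟩ := (hψ₁.isCharacter.mul hc).classInner_natCast hψ₂.isCharacter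
  have hcinv : ∀ h : alternatingGroup (Fin n), c (MulAut.conjNormal x h) = c h := fun h => by
    simp only [hcdef, MulAut.conjNormal_apply]
    exact (spechtRep ℂ γ).char_conj (h : Equiv.Perm (Fin n)) x
  have swapA := sum_swap_of_splitting hn hψ₁ hx hconj c hcinv (fun u _ u' _ => u * u')
  have swapB := sum_swap_of_splitting hn hψ₁ hx hconj c hcinv (fun u _ _ v' => u * v')
  have ha' : ∑ h : alternatingGroup (Fin n), c h * (ψ₁ h * ψ₁ h⁻¹) =
      Fintype.card (alternatingGroup (Fin n)) * a := by
    rw [← ha, ← sum_mul_apply_inv_eq_card_mul_classInner]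
    exact Finset.sum_congr rfl fun h _ => by simp only [Pi.mul_apply]; ring
  have hb' : ∑ h : alternatingGroup (Fin n), c h * (ψ₁ h * ψ₂ h⁻¹) =
      Fintype.card (alternatingGroup (Fin n)) * b := by
    rw [← hb, ← sum_mul_apply_inv_eq_card_mul_classInner]
    exact Finset.sum_congr rfl fun h _ => by simp only [Pi.mul_apply]; ring
  refine ⟨(a : ℤ) - b, ?_⟩
  have hterm : ∀ h : alternatingGroup (Fin n),
      (ψ₁ h - ψ₂ h) * (ψ₁ h⁻¹ - ψ₂ h⁻¹) * spechtCharacter ℂ γ h =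
        c h * (ψ₁ h * ψ₁ h⁻¹) - c h * (ψ₁ h * ψ₂ h⁻¹) - c h * (ψ₂ h * ψ₁ h⁻¹) +
          c h * (ψ₂ h * ψ₂ h⁻¹) := fun h => by simp only [hcdef]; ring
  rw [Finset.sum_congr rfl (fun h _ => hterm h), Finset.sum_add_distrib, Finset.sum_sub_distrib,
    Finset.sum_sub_distrib, ← swapA, ← swapB, ha', hb']
  push_cast
  ring

/-- **Concentration of `|θ|²` on one split class** (James–Kerber 2.5.13, steps (i)–(ii)): with `h₀`
an element of the support of `θ` of lexicographically minimal cycle type and `γ` the hook-adapted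
partition of `H1`, `Σ_{A_n} |θ|² χ^γ = N |θ(h₀)|² χ^γ(h₀) ∈ n! ℤ ∖ {0}` while `Σ_{A_n} |θ|² = n!`;
hence `θ` vanishes off the class of `h₀` and `N |θ(h₀)|² = n!` (`N` = size of the class).
[cite: JamesKerber1981, 2.5.13 proof step (ii)] -/
theorem theta_concentration_of_splitting (hn : 2 ≤ n) {ψ₁ ψ₂ : alternatingGroup (Fin n) → ℂ}
    (hψ₁ : IsIrrChar (alternatingGroup (Fin n)) ψ₁) (hψ₂ : IsIrrChar (alternatingGroup (Fin n)) ψ₂)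
    (hne : ψ₁ ≠ ψ₂) {x : Equiv.Perm (Fin n)} (hx : x ∉ alternatingGroup (Fin n))
    (hconj : ψ₂ = fun h => ψ₁ (MulAut.conjNormal x h))
    (H1 : ∀ g₀ : Equiv.Perm (Fin n), Subgroup.centralizer {g₀} ≤ alternatingGroup (Fin n) →
      ∃ γ : Nat.Partition n, (spechtCharacter ℂ γ g₀ = 1 ∨ spechtCharacter ℂ γ g₀ = -1) ∧
        ∀ g : Equiv.Perm (Fin n),
          List.Lex (· < ·) (g₀.cycleType.sort (· ≥ ·)) (g.cycleType.sort (· ≥ ·)) →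
            spechtCharacter ℂ γ g = 0) :
    ∃ h₀ : alternatingGroup (Fin n), ψ₁ h₀ - ψ₂ h₀ ≠ 0 ∧
      (∀ h : alternatingGroup (Fin n),
        (h : Equiv.Perm (Fin n)).cycleType ≠ (h₀ : Equiv.Perm (Fin n)).cycleType →
          ψ₁ h - ψ₂ h = 0) ∧
      (∀ h : alternatingGroup (Fin n),
        (h : Equiv.Perm (Fin n)).cycleType = (h₀ : Equiv.Perm (Fin n)).cycleType →
          (ψ₁ h - ψ₂ h) ^ 2 = (ψ₁ h₀ - ψ₂ h₀) ^ 2 ∧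
            (ψ₁ h - ψ₂ h) * (ψ₁ h⁻¹ - ψ₂ h⁻¹) = (ψ₁ h₀ - ψ₂ h₀) * (ψ₁ h₀⁻¹ - ψ₂ h₀⁻¹)) ∧
      (Finset.univ.filter fun h : alternatingGroup (Fin n) =>
          (h : Equiv.Perm (Fin n)).cycleType = (h₀ : Equiv.Perm (Fin n)).cycleType).card =
        (Finset.univ.filter fun g : Equiv.Perm (Fin n) =>
          g.cycleType = (h₀ : Equiv.Perm (Fin n)).cycleType).card ∧
      ((Finset.univ.filter fun g : Equiv.Perm (Fin n) =>
          g.cycleType = (h₀ : Equiv.Perm (Fin n)).cycleType).card : ℂ) *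
        ((ψ₁ h₀ - ψ₂ h₀) * (ψ₁ h₀⁻¹ - ψ₂ h₀⁻¹)) = n.factorial := by
  classical
  set θ : alternatingGroup (Fin n) → ℂ := fun h => ψ₁ h - ψ₂ h with hθ
  have hθinv : ∀ h, θ h⁻¹ = starRingEnd ℂ (θ h) := fun h => by
    simp only [hθ, map_sub, hψ₁.isCharacter.apply_inv_eq_conj, hψ₂.isCharacter.apply_inv_eq_conj]
  set r : alternatingGroup (Fin n) → ℝ := fun h => Complex.normSq (θ h) with hr
  have hθsq : ∀ h, θ h * θ h⁻¹ = (r h : ℂ) := fun h => by rw [hθinv, Complex.mul_conj]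
  -- total mass `Σ |θ|² = n!`
  have htot : ∑ h : alternatingGroup (Fin n), θ h * θ h⁻¹ = n.factorial := by
    rw [factorial_eq_two_mul_card_alternatingGroup hn]
    exact sum_theta_mul_theta_inv_of_splitting hψ₁ hψ₂ hne
  have htotR : ∑ h : alternatingGroup (Fin n), r h = n.factorial := by
    have h := htot
    simp only [hθsq] at h
    exact_mod_cast h
  -- the support is nonempty
  have hS : (Finset.univ.filter fun h : alternatingGroup (Fin n) => θ h ≠ 0).Nonempty := by
    by_contra hemp
    rw [Finset.not_nonempty_iff_eq_empty, Finset.filter_eq_empty_iff] at hemp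
    have h0 : ∑ h : alternatingGroup (Fin n), θ h * θ h⁻¹ = 0 :=
      Finset.sum_eq_zero fun h _ => by rw [not_not.mp (hemp (Finset.mem_univ h)), zero_mul]
    rw [h0] at htot
    exact Nat.cast_ne_zero.mpr n.factorial_ne_zero htot.symm
  -- a lexicographically minimal element of the support
  obtain ⟨h₀, hh₀, hmin⟩ := Finset.exists_min_image _
    (fun h : alternatingGroup (Fin n) => (h : Equiv.Perm (Fin n)).cycleType.sort (· ≥ ·)) hS
  have hθ₀ : θ h₀ ≠ 0 := (Finset.mem_filter.mp hh₀).2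
  have hsplit : Subgroup.centralizer {(h₀ : Equiv.Perm (Fin n))} ≤ alternatingGroup (Fin n) := by
    by_contra hc
    exact hθ₀ (theta_eq_zero_of_not_centralizer_le hn hψ₁ hx hconj h₀ hc)
  obtain ⟨γ, hγ₀, hγvan⟩ := H1 h₀ hsplit
  -- elements of the class of `h₀`
  set P : alternatingGroup (Fin n) → Prop := fun h =>
    (h : Equiv.Perm (Fin n)).cycleType = (h₀ : Equiv.Perm (Fin n)).cycleType with hP
  have hconjval : ∀ h : alternatingGroup (Fin n), P h →
      θ h ^ 2 = θ h₀ ^ 2 ∧ θ h * θ h⁻¹ = θ h₀ * θ h₀⁻¹ ∧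
        spechtCharacter ℂ γ h = spechtCharacter ℂ γ h₀ := by
    intro h hct
    obtain ⟨π, hπ⟩ := isConj_iff.mp (Equiv.Perm.isConj_iff_cycleType_eq.mpr hct.symm)
    have hh : h = MulAut.conjNormal π h₀ :=
      Subtype.ext (by rw [MulAut.conjNormal_apply]; exact hπ.symm)
    have hs : ((Equiv.Perm.sign π : ℤ) : ℂ) * ((Equiv.Perm.sign π : ℤ) : ℂ) = 1 := by
      rw [← Int.cast_mul, ← Units.val_mul, Int.units_mul_self, Units.val_one, Int.cast_one]
    have h1 : θ h = ((Equiv.Perm.sign π : ℤ) : ℂ) * θ h₀ := by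
      rw [hh]; exact theta_conjNormal_of_splitting hn hψ₁ hx hconj π h₀
    have h2 : θ h⁻¹ = ((Equiv.Perm.sign π : ℤ) : ℂ) * θ h₀⁻¹ := by
      rw [hh, ← map_inv]; exact theta_conjNormal_of_splitting hn hψ₁ hx hconj π h₀⁻¹
    refine ⟨?_, ?_, ?_⟩
    · rw [h1]; linear_combination (θ h₀ ^ 2) * hs
    · rw [h1, h2]; linear_combination (θ h₀ * θ h₀⁻¹) * hs
    · rw [hh, MulAut.conjNormal_apply]; exact (spechtRep ℂ γ).char_conj _ π
  -- `χ^γ` vanishes on the rest of the support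
  have hvan : ∀ h : alternatingGroup (Fin n), ¬ P h → θ h ≠ 0 → spechtCharacter ℂ γ h = 0 := by
    intro h hct hθh
    apply hγvan
    have hle := hmin h (Finset.mem_filter.mpr ⟨Finset.mem_univ _, hθh⟩)
    have hne' : (h₀ : Equiv.Perm (Fin n)).cycleType.sort (· ≥ ·) ≠
        (h : Equiv.Perm (Fin n)).cycleType.sort (· ≥ ·) := by
      intro heq
      apply hct
      have h' := congrArg (fun l : List ℕ => (l : Multiset ℕ)) heq
      simp only [Multiset.sort_eq] at h'
      exact h'.symm
    exact lt_of_le_of_ne hle hne'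
  -- `Σ |θ|² χ^γ = N_A |θ(h₀)|² χ^γ(h₀)`
  have hkey : ∀ h : alternatingGroup (Fin n), θ h * θ h⁻¹ * spechtCharacter ℂ γ h =
      if P h then θ h₀ * θ h₀⁻¹ * spechtCharacter ℂ γ h₀ else 0 := by
    intro h
    split_ifs with hp
    · obtain ⟨-, h1, h2⟩ := hconjval h hp
      rw [h1, h2]
    · by_cases hθh : θ h = 0
      · rw [hθh, zero_mul, zero_mul]
      · rw [hvan h hp hθh, mul_zero]
  obtain ⟨m, hm⟩ := exists_sum_theta_mul_theta_inv_mul_spechtCharacter_eq hn hψ₁ hψ₂ hx hconj γ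
  rw [Finset.sum_congr rfl (fun h _ => hkey h), Finset.sum_ite, Finset.sum_const_zero, add_zero,
    Finset.sum_const, nsmul_eq_mul, ← factorial_eq_two_mul_card_alternatingGroup hn, hθsq h₀] at hm
  -- hm : N_A * (r h₀ * χ^γ(h₀)) = n! * m
  -- the class of `h₀` in `A_n` is its class in `S_n`
  have hcount : (Finset.univ.filter P).card = (Finset.univ.filter fun g : Equiv.Perm (Fin n) =>
      g.cycleType = (h₀ : Equiv.Perm (Fin n)).cycleType).card := by
    apply Finset.card_bij (fun (h : alternatingGroup (Fin n)) _ => (h : Equiv.Perm (Fin n)))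
    · intro h hh
      simp only [Finset.mem_filter, Finset.mem_univ, true_and, hP] at hh ⊢
      exact hh
    · intro a _ b _ hab
      exact Subtype.ext hab
    · intro g hg
      simp only [Finset.mem_filter, Finset.mem_univ, true_and] at hg
      have hgA : g ∈ alternatingGroup (Fin n) := by
        rw [Equiv.Perm.mem_alternatingGroup, Equiv.Perm.sign_of_cycleType, hg,
          ← Equiv.Perm.sign_of_cycleType]
        exact Equiv.Perm.mem_alternatingGroup.mp h₀.2
      exact ⟨⟨g, hgA⟩, by simp only [Finset.mem_filter, Finset.mem_univ, true_and, hP]; exact hg,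
        rfl⟩
  set N := (Finset.univ.filter fun g : Equiv.Perm (Fin n) =>
      g.cycleType = (h₀ : Equiv.Perm (Fin n)).cycleType).card with hN
  rw [hcount] at hm
  -- `N r(h₀) = n! m'` with `m'` a positive integer
  have hNr : ∃ m' : ℤ, (N : ℝ) * r h₀ = n.factorial * m' := by
    rcases hγ₀ with he1 | he1
    · refine ⟨m, ?_⟩
      rw [he1, mul_one] at hm
      exact_mod_cast hm
    · refine ⟨-m, ?_⟩
      rw [he1] at hm
      have hm' : (N : ℂ) * (r h₀ : ℂ) = n.factorial * (((-m : ℤ)) : ℂ) := by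
        push_cast; linear_combination -hm
      exact_mod_cast hm'
  obtain ⟨m', hm'⟩ := hNr
  have hrpos : 0 < r h₀ := Complex.normSq_pos.mpr hθ₀
  have hNpos : 0 < N := Finset.card_pos.mpr ⟨h₀, Finset.mem_filter.mpr ⟨Finset.mem_univ _, rfl⟩⟩
  have hm'pos : (1 : ℤ) ≤ m' := by
    have h1 : (0 : ℝ) < n.factorial * m' := by
      rw [← hm']; exact mul_pos (by exact_mod_cast hNpos) hrpos
    have h2 : (0 : ℝ) < m' := (mul_pos_iff_of_pos_left (by positivity)).mp h1
    exact_mod_cast h2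
  have hge : (n.factorial : ℝ) ≤ N * r h₀ := by
    rw [hm']
    have : (1 : ℝ) ≤ m' := by exact_mod_cast hm'pos
    nlinarith [Nat.cast_nonneg (α := ℝ) n.factorial]
  -- split the total mass along the class of `h₀`
  have hclass : ∑ h ∈ Finset.univ.filter P, r h = N * r h₀ := by
    rw [Finset.sum_congr rfl (fun h hh => ?_), Finset.sum_const, nsmul_eq_mul, hcount]
    have hp : P h := (Finset.mem_filter.mp hh).2
    have h' := (hconjval h hp).2.1
    rw [hθsq, hθsq] at h'
    exact_mod_cast h'
  have hrest : ∑ h ∈ Finset.univ.filter (fun h => ¬ P h), r h = 0 := by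
    have hsplit_sum := Finset.sum_filter_add_sum_filter_not Finset.univ P r
    rw [htotR, hclass] at hsplit_sum
    have hnn : 0 ≤ ∑ h ∈ Finset.univ.filter (fun h => ¬ P h), r h :=
      Finset.sum_nonneg fun h _ => Complex.normSq_nonneg _
    linarith
  have hoff : ∀ h : alternatingGroup (Fin n), ¬ P h → θ h = 0 := by
    intro h hp
    have h0 := (Finset.sum_eq_zero_iff_of_nonneg (fun h _ => Complex.normSq_nonneg (θ h))).mp hrest h
      (Finset.mem_filter.mpr ⟨Finset.mem_univ _, hp⟩)
    exact Complex.normSq_eq_zero.mp h0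
  have hNw : (N : ℝ) * r h₀ = n.factorial := by
    have hsplit_sum := Finset.sum_filter_add_sum_filter_not Finset.univ P r
    rw [htotR, hclass, hrest, add_zero] at hsplit_sum
    exact hsplit_sum
  refine ⟨h₀, hθ₀, fun h hp => hoff h hp, fun h hp => ⟨(hconjval h hp).1, (hconjval h hp).2.1⟩,
    hcount, ?_⟩
  rw [hθsq h₀]
  exact_mod_cast hNw

/-! ### Assembly -/

/-- **Bessenrodt–Behns Cor. 3.2 for one `λ = λᵀ ⊢ n`, from the two Murnaghan–Nakayama hook values.**
`H1`: hook-adapted characters for the split classes of `S_n` (James–Kerber 2.4.8/2.4.9); `H2`: a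
permutation `σ` with `χ^λ(σ) = ε = ±1` and `∏ (cycle lengths of σ) ≡ ε (mod 4)` (James–Kerber 2.4.8
with 2.5.12 at the class `h(λ)`). Conclusion: `g(λ,λ,λ) > 0` and `g(λ,λ,λ) ≡ 1 (mod 4)`.
[cite: BessenrodtBehns2004, Thm. 3.1 and Cor. 3.2] [cite: JamesKerber1981, 2.5.13] -/
theorem kroneckerCoeff_self_pos_and_mod_four_of_hookValues (lam : Nat.Partition n)
    (hT : lam.transpose = lam)
    (H1 : ∀ g₀ : Equiv.Perm (Fin n), Subgroup.centralizer {g₀} ≤ alternatingGroup (Fin n) →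
      ∃ γ : Nat.Partition n, (spechtCharacter ℂ γ g₀ = 1 ∨ spechtCharacter ℂ γ g₀ = -1) ∧
        ∀ g : Equiv.Perm (Fin n),
          List.Lex (· < ·) (g₀.cycleType.sort (· ≥ ·)) (g.cycleType.sort (· ≥ ·)) →
            spechtCharacter ℂ γ g = 0)
    (H2 : ∃ (σ : Equiv.Perm (Fin n)) (e : ℤ), (e = 1 ∨ e = -1) ∧ spechtCharacter ℂ lam σ = e ∧
      (4 : ℤ) ∣ ((σ.cycleType.prod : ℕ) : ℤ) - e) :
    0 < kroneckerCoeff ℂ lam lam lam ∧ kroneckerCoeff ℂ lam lam lam % 4 = 1 := by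
  classical
  by_cases hn : n ≤ 1
  · rw [kroneckerCoeff_self_of_le_one hn]
    exact ⟨Nat.one_pos, rfl⟩
  have hn2 : 2 ≤ n := by omega
  obtain ⟨ψ₁, ψ₂, x, hψ₁, hψ₂, hne, hsum, hx, hconj⟩ := exists_alternating_splitting hn2 lam hT
  obtain ⟨p, q, hg, hS⟩ := kroneckerCoeff_eq_of_splitting hn2 lam hT hψ₁ hψ₂ hx hconj hsum
  have hA0 : (Fintype.card (alternatingGroup (Fin n)) : ℂ) ≠ 0 :=
    Nat.cast_ne_zero.mpr Fintype.card_ne_zero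
  -- it suffices to prove Frobenius's identity `Σ_{A_n} χ θ² = 2 |A_n|`
  suffices hmain : ∑ h : alternatingGroup (Fin n), spechtCharacter ℂ lam h * (ψ₁ h - ψ₂ h) ^ 2 =
      2 * Fintype.card (alternatingGroup (Fin n)) by
    rw [hmain] at hS
    have hpq : (p : ℂ) = q + 1 := by
      have h' := mul_left_cancel₀ hA0 (show (Fintype.card (alternatingGroup (Fin n)) : ℂ) * 2 =
        Fintype.card (alternatingGroup (Fin n)) * (2 * p - 2 * q) by linear_combination hS)
      linear_combination -h' / 2
    have hpq' : p = q + 1 := by exact_mod_cast hpq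
    have hg' : kroneckerCoeff ℂ lam lam lam = 4 * q + 1 := by
      have h' : (kroneckerCoeff ℂ lam lam lam : ℂ) = (4 * q + 1 : ℕ) := by
        rw [hg, hpq']; push_cast; ring
      exact_mod_cast h'
    rw [hg']
    constructor <;> omega
  -- Frobenius's theorem: concentration
  obtain ⟨h₀, -, hoff, hcls, hcount, hNw⟩ :=
    theta_concentration_of_splitting hn2 hψ₁ hψ₂ hne hx hconj H1
  obtain ⟨σ, e, he, hχσ, hdvd⟩ := H2
  have he' : (e : ℂ) = 1 ∨ (e : ℂ) = -1 := by
    rcases he with rfl | rfl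
    · left; norm_num
    · right; norm_num
  have hσA : σ ∈ alternatingGroup (Fin n) :=
    mem_alternatingGroup_of_spechtCharacter_ne_zero lam hT (by
      rw [hχσ]; rcases he' with h | h <;> rw [h] <;> norm_num)
  set σ' : alternatingGroup (Fin n) := ⟨σ, hσA⟩ with hσ'
  -- `2 ψ₁(σ) = ε + θ(σ)`, so `θ(σ) ≠ 0` by integrality (James–Kerber 2.5.13 (v))
  have hψ₁σ : 2 * ψ₁ σ' = e + (ψ₁ σ' - ψ₂ σ') := by
    have h := congrFun hsum σ'
    simp only [Pi.add_apply] at h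
    rw [← hχσ]
    linear_combination -h
  have hθσ : ψ₁ σ' - ψ₂ σ' ≠ 0 := by
    intro h0
    rw [h0, add_zero] at hψ₁σ
    exact two_mul_ne_of_isIntegral_int (hψ₁.isCharacter.isIntegral_apply σ') he' hψ₁σ
  -- hence `σ` lies in the class carrying `θ`, which is split
  have hct : σ.cycleType = (h₀ : Equiv.Perm (Fin n)).cycleType := by
    by_contra hne'
    exact hθσ (hoff σ' hne')
  have hsplit : Subgroup.centralizer {σ} ≤ alternatingGroup (Fin n) := by
    by_contra hc
    exact hθσ (theta_eq_zero_of_not_centralizer_le hn2 hψ₁ hx hconj σ' hc)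
  rw [← hct] at hoff hcls hcount hNw
  -- `N z = n!` with `z = ∏ cycle lengths` (Mathlib), `N |θ(σ)|² = n!` (concentration)
  set N := (Finset.univ.filter fun g : Equiv.Perm (Fin n) => g.cycleType = σ.cycleType).card
    with hN
  set z : ℕ := σ.cycleType.prod with hz
  have hNz : N * z = n.factorial := by
    have h := Equiv.Perm.card_of_cycleType_mul_eq (α := Fin n) σ.cycleType
    rw [if_pos ⟨σ.sum_cycleType_le, fun a ha => Equiv.Perm.two_le_of_mem_cycleType ha⟩] at h
    rw [Equiv.Perm.centralizer_le_alternating_iff, Fintype.card_fin] at hsplit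
    obtain ⟨-, hcard, hcnt⟩ := hsplit
    have h1 : (Fintype.card (Fin n) - σ.cycleType.sum).factorial = 1 :=
      Nat.factorial_eq_one.mpr (by rw [Fintype.card_fin]; omega)
    have h2 : ∏ a ∈ σ.cycleType.toFinset, (σ.cycleType.count a).factorial = 1 :=
      Finset.prod_eq_one fun a _ => Nat.factorial_eq_one.mpr (hcnt a)
    rw [h1, h2, one_mul, mul_one, Fintype.card_fin] at h
    exact h
  have hN0 : (N : ℂ) ≠ 0 := by
    have : 0 < N := Finset.card_pos.mpr ⟨σ, Finset.mem_filter.mpr ⟨Finset.mem_univ _, rfl⟩⟩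
    exact_mod_cast this.ne'
  obtain ⟨hsqσ, hwσ⟩ := hcls σ' rfl
  have hwz : (ψ₁ σ' - ψ₂ σ') * (ψ₁ σ'⁻¹ - ψ₂ σ'⁻¹) = z := by
    apply mul_left_cancel₀ hN0
    rw [hwσ, hNw, ← hNz, Nat.cast_mul]
  -- `θ(σ⁻¹) = ± θ(σ)` (`σ⁻¹ ~ σ`), so `θ(σ)² = s z`, `s = ±1`
  obtain ⟨π, hπ⟩ := isConj_iff.mp
    (Equiv.Perm.isConj_iff_cycleType_eq.mpr (Equiv.Perm.cycleType_inv σ).symm)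
  have hinv : σ'⁻¹ = MulAut.conjNormal π σ' :=
    Subtype.ext (by rw [MulAut.conjNormal_apply]; exact hπ.symm)
  set s : ℂ := ((Equiv.Perm.sign π : ℤ) : ℂ) with hsdef
  have hs : s = 1 ∨ s = -1 := by
    rcases Int.units_eq_one_or (Equiv.Perm.sign π) with h | h
    · left; rw [hsdef, h, Units.val_one, Int.cast_one]
    · right; rw [hsdef, h, Units.val_neg, Units.val_one, Int.cast_neg, Int.cast_one]
  have hs2 : s * s = 1 := by rcases hs with h | h <;> rw [h] <;> norm_num
  have hθinvσ : ψ₁ σ'⁻¹ - ψ₂ σ'⁻¹ = s * (ψ₁ σ' - ψ₂ σ') := by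
    rw [hinv]; exact theta_conjNormal_of_splitting hn2 hψ₁ hx hconj π σ'
  have hx2 : (ψ₁ σ' - ψ₂ σ') ^ 2 = s * z := by
    rw [hθinvσ] at hwz
    linear_combination s * hwz - (ψ₁ σ' - ψ₂ σ') ^ 2 * hs2
  -- the sign: `s = ε` (an algebraic-integer argument modulo `4`)
  have he2 : (e : ℂ) * e = 1 := by rcases he' with h | h <;> rw [h] <;> norm_num
  have hse : s = (e : ℂ) := by
    by_contra hsne
    have hs' : s = -(e : ℂ) := by
      rcases hs with h | h <;> rcases he' with h' | h'
      · exact absurd (h.trans h'.symm) hsne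
      · rw [h, h']; norm_num
      · rw [h, h']
      · exact absurd (h.trans h'.symm) hsne
    obtain ⟨m4, hm4⟩ := hdvd
    have hzc : (z : ℂ) = e + 4 * m4 := by
      have h' : ((z : ℤ) : ℂ) = ((e + 4 * m4 : ℤ) : ℂ) := by
        rw [show (z : ℤ) = e + 4 * m4 by omega]
      push_cast at h'
      exact h'
    have hE : IsIntegral ℤ (e : ℂ) := by
      rw [← eq_intCast (algebraMap ℤ ℂ) e]; exact isIntegral_algebraMap
    have hM : IsIntegral ℤ (m4 : ℂ) := by
      rw [← eq_intCast (algebraMap ℤ ℂ) m4]; exact isIntegral_algebraMap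
    have ht : IsIntegral ℤ (ψ₁ σ') := hψ₁.isCharacter.isIntegral_apply σ'
    have hu : IsIntegral ℤ (ψ₁ σ' ^ 2 - e * ψ₁ σ' + e * m4) :=
      ((ht.pow 2).sub (hE.mul ht)).add (hE.mul hM)
    have hx2' : (ψ₁ σ' - ψ₂ σ') ^ 2 = -(e : ℂ) * z := by rw [hx2, hs']
    have h2u : 2 * (ψ₁ σ' ^ 2 - e * ψ₁ σ' + e * m4) = -1 := by
      linear_combination (ψ₁ σ' + ((e : ℂ) + (ψ₁ σ' - ψ₂ σ')) / 2 - e) * hψ₁σ + (1 / 2 : ℂ) * hx2' -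
        ((e : ℂ) / 2) * hzc - he2
    exact two_mul_ne_of_isIntegral_int hu (Or.inr rfl) h2u
  -- conclusion: `Σ_{A_n} χ θ² = N_A · ε θ(σ)² = N ε (ε z) = N z = n!`
  set P : alternatingGroup (Fin n) → Prop := fun h =>
    (h : Equiv.Perm (Fin n)).cycleType = σ.cycleType with hP
  have hkey : ∀ h : alternatingGroup (Fin n), spechtCharacter ℂ lam h * (ψ₁ h - ψ₂ h) ^ 2 =
      if P h then (e : ℂ) * (ψ₁ σ' - ψ₂ σ') ^ 2 else 0 := by
    intro h
    split_ifs with hp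
    · obtain ⟨hsq, -⟩ := hcls h hp
      obtain ⟨κ, hκ⟩ := isConj_iff.mp (Equiv.Perm.isConj_iff_cycleType_eq.mpr
        (show σ.cycleType = (h : Equiv.Perm (Fin n)).cycleType from hp.symm))
      rw [hsq, ← hsqσ, ← hχσ, ← hκ]
      congr 1
      exact (spechtRep ℂ lam).char_conj σ κ
    · rw [hoff h hp]; ring
  rw [Finset.sum_congr rfl (fun h _ => hkey h), Finset.sum_ite, Finset.sum_const_zero, add_zero,
    Finset.sum_const, nsmul_eq_mul, hcount, hx2, hse, ← mul_assoc (e : ℂ), he2, one_mul,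
    ← Nat.cast_mul, hNz, factorial_eq_two_mul_card_alternatingGroup hn2]

/-- **Bessenrodt–Behns 2004, Cor. 3.2, from the two Murnaghan–Nakayama hook values** (James–Kerber
2.4.8/2.4.9; the companion file `SymmetricGroupPrincipalHookValues.lean` discharges `H1`, `H2` from
Frobenius's character formula). [cite: BessenrodtBehns2004, Cor. 3.2] -/
theorem BessenrodtBehns2004_cor_3_2_of_hookValues
    (H1 : ∀ (n : ℕ) (g₀ : Equiv.Perm (Fin n)),
      Subgroup.centralizer {g₀} ≤ alternatingGroup (Fin n) →
      ∃ γ : Nat.Partition n, (spechtCharacter ℂ γ g₀ = 1 ∨ spechtCharacter ℂ γ g₀ = -1) ∧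
        ∀ g : Equiv.Perm (Fin n),
          List.Lex (· < ·) (g₀.cycleType.sort (· ≥ ·)) (g.cycleType.sort (· ≥ ·)) →
            spechtCharacter ℂ γ g = 0)
    (H2 : ∀ (n : ℕ) (lam : Nat.Partition n), lam.transpose = lam →
      ∃ (σ : Equiv.Perm (Fin n)) (e : ℤ), (e = 1 ∨ e = -1) ∧ spechtCharacter ℂ lam σ = e ∧
        (4 : ℤ) ∣ ((σ.cycleType.prod : ℕ) : ℤ) - e) :
    BessenrodtBehns2004_cor_3_2 :=
  fun n lam hT => kroneckerCoeff_self_pos_and_mod_four_of_hookValues lam hT (H1 n) (H2 n lam hT)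

end Literature.RepresentationTheory.FiniteGroups

end
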